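import Mathlib
import HarnessLib
import Literature.NumberTheory.LFunctions.ZetaScrew
import Literature.NumberTheory.LFunctions.ZetaScrewLogTwoPos
import Summits.RiemannHypothesis.RiemannHypothesis.Theses.IntegerScrew
import Summits.RiemannHypothesis.RiemannHypothesis.Theorems.IntegerScrewDefs
import Summits.RiemannHypothesis.RiemannHypothesis.Theorems.IntegerScrewNestedSylvester
import Summits.RiemannHypothesis.RiemannHypothesis.Theorems.IntegerScrewFloorOfRH
import Summits.RiemannHypothesis.RiemannHypothesis.Theorems.IntegerScrewDiscreteLandau

/-!
# Route `IntegerScrew` — the PIVOT CRITERION: `RH ↔ ∀ M ≥ 2, d_M > 0` for the nested screw matrices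

WHAT IS PRINTED (Suzuki 2023, J. Lond. Math. Soc. (2) 108, 1448–1487 = arXiv:2206.03682). With
`Ψ` of (1.1) (even extension, `Ψ(0) = 0`; tree `zetaScrew`) and `g := −Ψ` (1.8), Kreĭn's kernel (1.4)
is `G_g(t,u) = g(t−u) − g(t) − g(−u) + g(0) = Ψ(t) + Ψ(u) − Ψ(t−u)` (tree `zetaScrewKernel`), and
THEOREM 1.2 reads: "The RH is true if and only if `g(t)` defined by (1.8) is a screw function on
`ℝ = (−∞, ∞)`", i.e. `g ∈ 𝒢_∞`: `g` continuous, `g(−t) = conj g(t)`, and `G_g` NON-NEGATIVE definite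
on `ℝ` in the sense (1.5): `∑_{i,j=1}^n G_g(t_i,t_j) ξ_i conj(ξ_j) ≥ 0` for ALL `n`, ALL REAL `t_i`
and complex `ξ_i`. So Suzuki's printed criterion is SEMI-definiteness (`⪰ 0`) on ALL finite REAL
configurations (tree: `Suzuki2023_thm12_holds`); THEOREM 1.7: `RH ↔ Ψ(t) ≥ 0 ∀ t ∈ ℝ`, and under RH
`Ψ(t) > 0` for `t ≠ 0` (tree: `Suzuki2023_thm17_holds`). Strictness is printed only pointwise
(Thm 1.7) and for the `L²(−a,a)` forms (Thm 1.3 "moreover", Thm 1.4), never for finite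
configurations; the restriction to the nodes `t = log m`, `m ∈ ℕ`, is NOT in Suzuki's papers (nearest
print: Suzuki, arXiv:2411.07436 Thm 1, the diagonal `Ψ(log x) ≥ 0` for real `x ≥ x₀`).

WHAT THE TREE PROVES (route `IntegerScrew`, all kernel-checked, axioms standard) and this file
assembles for the NESTED matrices `S_M = [G(log m, log m')]_{2≤m,m'≤M} = screwMatrix (M − 1)`
(`Theorems/IntegerScrewDefs.lean`):

* `riemannHypothesis_iff_screwMatrix_posSemidef` : `RH ↔ ∀ n, (screwMatrix n).PosSemidef`.
  (←) only the DIAGONAL is used: `0 ≤ S_M(m,m) = 2Ψ(log m)` for all `m`, then the route's RH-free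
  detection `DiscreteLandau_proof` (Landau's theorem on `∑ Ψ(log m) m^{−s}`); (→) via the next item.
* `riemannHypothesis_iff_screwMatrix_posDef` : `RH ↔ ∀ n, (screwMatrix n).PosDef` — STRICT. (→) is the
  route's `floorOfRH_proof` (RH ⇒ `x·S_M·x ≥ c M^{−A}‖x‖²`, a polynomial floor, in particular `> 0`).
  Hence for THIS family `⪰` for all `M` and `≻` for all `M` are the same statement
  (`screwMatrix_posSemidef_iff_posDef`) — both are RH; this is not a general fact about kernels.
* (from `Theorems/IntegerScrewNestedSylvester.lean`) `screwMatrix_posDef_iff_screwPivot_pos` :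
  `(∀ n, (screwMatrix n).PosDef) ↔ ∀ M ≥ 2, 0 < screwPivot M` — pure linear algebra for a NESTED family
  (strict Schur-complement step + bordered determinant), finite form
  `screwMatrix_posDef_iff_screwPivot_pos_le` (`S_{N+1} ≻ 0 ↔ d_2 … d_{N+1} > 0`), `d_2 = 2Ψ(log 2)`.
* `riemannHypothesis_iff_screwPivot_pos` : **`RH ↔ ∀ M ≥ 2, 0 < d_M`**, and the directive's shape
  `riemannHypothesis_iff_base_and_pivots` : `RH ↔ (0 < 2Ψ(log 2) ∧ ∀ M ≥ 3, 0 < d_M)`; the base clause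
  is discharged unconditionally (`screwPivot_two_pos`, from `zetaScrew_log_two_pos`, Suzuki2023 Thm 4.1
  at `t = log 2` proved in `Literature/…/ZetaScrewLogTwoPos.lean`), whence
  `riemannHypothesis_iff_screwPivot_pos_three` : `RH ↔ ∀ M ≥ 3, 0 < d_M`; summit form
  `summit_iff_screwPivot_pos`.

BOUNDARY CASES recorded by the statements: the node `log 1 = 0` is excluded (with it every `S_M` has
a zero row: `⪰` unchanged, `≻` false, pivot `0`); `M = 2` is the `1 × 1` base `[2Ψ(log 2)]`
(`= 0.1271…`; `0 < 2Ψ(log 2)` is the tree theorem `zetaScrew_log_two_pos`, so `S_2 ≻ 0` unconditionally); no limit in `M` is involved (each rung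
is a finite matrix; by nestedness `λ_min(S_M)` is non-increasing in `M`, a single `d_M > 0` says
nothing about `M + 1`). No statement here suggests RH: every `↔` above has RH on one side.
-/

noncomputable section

-- D-0017: `Summit.<S>.<S>.…` is the designed namespace of a single-problem summit.
set_option linter.dupNamespace false

namespace Summit.RiemannHypothesis.RiemannHypothesis.Theorems.IntegerScrew

open Literature.NumberTheory.LFunctions Matrix
open Literature.NumberTheory.ModularForms.SiegelModularForm (posDef_fin_one_iff)
open scoped BigOperators

/-! ### `RH ↔ ∀ M, S_M ⪰ 0 ↔ ∀ M, S_M ≻ 0` -/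

/-- If every `S_M` is positive semidefinite then `Ψ(log m) ≥ 0` for every positive integer `m`
(one-point configurations: the diagonal; `Ψ(log 1) = Ψ(0) = 0`). [folklore] -/
theorem zetaScrew_log_nonneg_of_posSemidef (h : ∀ n, (screwMatrix n).PosSemidef) :
    ∀ m : ℕ, 1 ≤ m → 0 ≤ zetaScrew (Real.log m) := by
  intro m hm
  rcases Nat.lt_or_ge m 2 with hlt | hge
  · have h1 : m = 1 := by omega
    subst h1
    simp [zetaScrew_zero]
  · have hd := (h (m - 1)).diag_nonneg (i := ⟨m - 2, by omega⟩)
    rw [screwMatrix_diag] at hd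
    have hm2 : (m - 2 + 2 : ℕ) = m := by omega
    simp only [hm2] at hd
    linarith

/-- `∀ M, S_M ⪰ 0 ⟹ RH`, through the DIAGONAL only and the route's RH-free detection crux
`DiscreteLandau` (proved in the tree: `IntegerScrewDiscreteLandau.DiscreteLandau_proof`). [folklore] -/
theorem riemannHypothesis_of_screwMatrix_posSemidef (h : ∀ n, (screwMatrix n).PosSemidef) :
    _root_.RiemannHypothesis :=
  Summit.RiemannHypothesis.RiemannHypothesis.Theorems.IntegerScrewDiscreteLandau.DiscreteLandau_proof
    (zetaScrew_log_nonneg_of_posSemidef h)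

/-- `RH ⟹ ∀ M, S_M ≻ 0` (STRICT): the route's floor law under RH, `floorOfRH_proof`
(`x·S_M·x ≥ c M^{−A} ∑ x_m²` with `c > 0`), tested on a non-zero vector. Suzuki2023 Thm 1.2 prints
only `⪰` (for all real configurations); strictness here is the tree's theorem. [folklore] -/
theorem screwMatrix_posDef_of_riemannHypothesis (hRH : _root_.RiemannHypothesis) (n : ℕ) :
    (screwMatrix n).PosDef := by
  obtain ⟨A, c, hc, hfloor⟩ :=
    Summit.RiemannHypothesis.RiemannHypothesis.Theorems.floorOfRH_proof hRH
  refine Matrix.PosDef.of_dotProduct_mulVec_pos (screwMatrix_isHermitian n) fun v hv => ?_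
  set x : ℕ → ℝ := fun k => if h : k - 2 < n then v ⟨k - 2, h⟩ else 0 with hxdef
  have hx : ∀ i : Fin n, x ((i : ℕ) + 2) = v i := by
    intro i
    simp [hxdef]
  have hform := screwMatrix_form_eq_Icc n v x hx
  have hfl := hfloor (n + 1) x
  have hsq : ∑ m ∈ Finset.Icc 2 (n + 1), x m ^ 2 = ∑ i : Fin n, v i ^ 2 := by
    simp only [sum_Icc_two_eq_sum_fin, hx]
  have hpos : 0 < ∑ i : Fin n, v i ^ 2 := by
    obtain ⟨i, hi⟩ : ∃ i, v i ≠ 0 := by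
      by_contra hcon
      push Not at hcon
      exact hv (funext hcon)
    exact lt_of_lt_of_le (by positivity : 0 < v i ^ 2)
      (Finset.single_le_sum (f := fun j => v j ^ 2) (fun j _ => sq_nonneg (v j)) (Finset.mem_univ i))
  have hM : 0 < c * ((n + 1 : ℕ) : ℝ) ^ (-A) * ∑ m ∈ Finset.Icc 2 (n + 1), x m ^ 2 := by
    rw [hsq]
    exact mul_pos (mul_pos hc (Real.rpow_pos_of_pos (by positivity) _)) hpos
  rw [hform]
  exact lt_of_lt_of_le hM hfl

/-- **`RH ↔ every nested screw matrix is positive SEMIDEFINITE`** — Suzuki2023 Thm 1.2 restricted to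
the integer nodes (→, through the floor) together with the route's RH-free detection (←, diagonal +
`DiscreteLandau`). [cite: Suzuki2023, Thm 1.2] -/
theorem riemannHypothesis_iff_screwMatrix_posSemidef :
    _root_.RiemannHypothesis ↔ ∀ n, (screwMatrix n).PosSemidef :=
  ⟨fun h n => (screwMatrix_posDef_of_riemannHypothesis h n).posSemidef,
    riemannHypothesis_of_screwMatrix_posSemidef⟩

/-- **`RH ↔ every nested screw matrix is positive DEFINITE`** (strict; → is the route's
`floorOfRH_proof`, ← as above). [cite: Suzuki2023, Thm 1.2] -/
theorem riemannHypothesis_iff_screwMatrix_posDef :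
    _root_.RiemannHypothesis ↔ ∀ n, (screwMatrix n).PosDef :=
  ⟨screwMatrix_posDef_of_riemannHypothesis,
    fun h => riemannHypothesis_of_screwMatrix_posSemidef fun n => (h n).posSemidef⟩

/-- For THIS nested family, "all `S_M ⪰ 0`" and "all `S_M ≻ 0`" are the same statement (both are RH;
the proof passes through the two RH-detections, it is not a kernel-level fact). [folklore] -/
theorem screwMatrix_posSemidef_iff_posDef :
    (∀ n, (screwMatrix n).PosSemidef) ↔ ∀ n, (screwMatrix n).PosDef := by
  rw [← riemannHypothesis_iff_screwMatrix_posSemidef, riemannHypothesis_iff_screwMatrix_posDef]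

/-! ### The pivot criterion -/

/-- **PIVOT CRITERION.** `RH ↔ ∀ M ≥ 2, d_M > 0`, where `d_M = det S_M / det S_{M−1}` are the LDLᵀ
pivots of the nested screw Gram matrices `S_M = [Ψ(log m) + Ψ(log m') − Ψ(log(m/m'))]_{2≤m,m'≤M}`.
Ingredients: Suzuki2023 Thm 1.2 (as the tree's `floorOfRH_proof`, RH ⇒ strict floor) for (→); the
diagonal + `DiscreteLandau_proof` for (←); Sylvester on the nested minors in between. An
RH-EQUIVALENCE, not evidence for RH. [cite: Suzuki2023, Thm 1.2 and Thm 1.7] -/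
theorem riemannHypothesis_iff_screwPivot_pos :
    _root_.RiemannHypothesis ↔ ∀ M : ℕ, 2 ≤ M → 0 < screwPivot M := by
  rw [riemannHypothesis_iff_screwMatrix_posDef, screwMatrix_posDef_iff_screwPivot_pos]

/-- The directive's shape `RH ↔ S₁ > 0 ∧ ∀ M, d_M > 0`: with the cell's indexing (`S_M` on the nodes
`2..M`, first matrix `S_2 = [2Ψ(log 2)]`) it reads `RH ↔ (0 < 2Ψ(log 2) ∧ ∀ M ≥ 3, 0 < d_M)`.
[cite: Suzuki2023, Thm 1.2 and Thm 1.7] -/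
theorem riemannHypothesis_iff_base_and_pivots :
    _root_.RiemannHypothesis ↔
      0 < 2 * zetaScrew (Real.log 2) ∧ ∀ M : ℕ, 3 ≤ M → 0 < screwPivot M := by
  rw [riemannHypothesis_iff_screwPivot_pos]
  constructor
  · intro h
    exact ⟨screwPivot_two ▸ h 2 le_rfl, fun M hM => h M (by omega)⟩
  · rintro ⟨h2, h3⟩ M hM
    rcases Nat.lt_or_ge M 3 with hlt | hge
    · have : M = 2 := by omega
      subst this
      rwa [screwPivot_two]
    · exact h3 M hge

/-- The base pivot is positive unconditionally: `d_2 = 2Ψ(log 2) > 0` (Suzuki2023 Thm 4.1 at `t = log 2`,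
tree `zetaScrew_log_two_pos`), i.e. `S_2 = [2Ψ(log 2)] ≻ 0`. [cite: Suzuki2023, Thm 4.1] -/
theorem screwPivot_two_pos : 0 < screwPivot 2 := by
  rw [screwPivot_two]
  exact mul_pos two_pos zetaScrew_log_two_pos

/-- `S_2 = screwMatrix 1 ≻ 0` unconditionally. [cite: Suzuki2023, Thm 4.1] -/
theorem screwMatrix_one_posDef : (screwMatrix 1).PosDef := by
  rw [posDef_fin_one_iff, screwMatrix_diag]
  norm_num
  exact zetaScrew_log_two_pos

/-- **PIVOT CRITERION, base discharged.** `RH ↔ ∀ M ≥ 3, d_M > 0` (the clause `d_2 > 0` holds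
unconditionally). [cite: Suzuki2023, Thm 1.2 and Thm 4.1] -/
theorem riemannHypothesis_iff_screwPivot_pos_three :
    _root_.RiemannHypothesis ↔ ∀ M : ℕ, 3 ≤ M → 0 < screwPivot M := by
  rw [riemannHypothesis_iff_base_and_pivots]
  exact ⟨fun h => h.2, fun h => ⟨by simpa [screwPivot_two] using screwPivot_two_pos, h⟩⟩

/-- Summit form of the pivot criterion (`Summit.RiemannHypothesis` is Mathlib's `RiemannHypothesis`).
[cite: Suzuki2023, Thm 1.2 and Thm 1.7] -/
theorem summit_iff_screwPivot_pos :
    _root_.Summit.RiemannHypothesis ↔ ∀ M : ℕ, 2 ≤ M → 0 < screwPivot M := by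
  rw [_root_.Summit.RiemannHypothesis_iff, riemannHypothesis_iff_screwPivot_pos]

end Summit.RiemannHypothesis.RiemannHypothesis.Theorems.IntegerScrew
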